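import Summits.QuantumFields.QCD.Theses.NestedDissectionSea
import Literature.MathematicalPhysics.QuantumFieldTheory.QuasiLocalGaugePerturbationKernels

/-!
# Line `local-ac-open-certificate` for the crux `RobustYangMills` (stmt-QuantumFields-13897) —
# base module: vocabulary §0–§1, the CLOSED lever `stub_localAC`, the diagonal fragment

Crux: `Summit.QuantumFields.QCD.Theses.NestedDissectionSea.RobustYangMills` (shared verbatim with
`HeavyThresholdYMBridge` / `AdaptiveBlockFermions`), item stmt-QuantumFields-13897; checked skeleton
`Cruxes/RobustYangMills/Lines/local-ac-open-certificate.lean` (lead `prover-line-stmt-QuantumFields-13897-0`,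
line card `Lines/local-ac-open-certificate.md`, PICKED.md on the item). This module carries, verbatim from
the skeleton (docstrings shortened to one line; full prose in the skeleton): §0 the crux's sub-terms named
(`AdmAt`, `ClauseConv`, `ClauseCluster`, `ClauseLip`, `ClauseLipOff`, `ClauseLipFrag`, `ClauseLipCoin`,
`Concl`, `budget`, `Explicit`); §1 the perturbed torus specification `spec ρ β W` and the local-absolute-
continuity toolkit `LocalACToolkit = KernelACInW ∧ KernelQuasiLocality ∧ KernelDLR`; the two Props
`DiagonalFragment` / `CoincidentResponse` into which the lead's reshape r2 split the former SUSPECT stub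
`DiagonalExtension`; and two CLOSED stubs: `stub_localAC : LocalACToolkit` (the three kernel facts are the
Literature theorems of `QuasiLocalGaugePerturbationKernels`; `spec`, `RangeControl`, `NearBlocks` unfold to
their hypotheses definitionally) and `stub_diagonalFragment : DiagonalFragment` (the `n = 0` instance of
clause (iv) holds because both `0`-point functions are `1`; otherwise the given off-diagonal tensor feeds
clause (iv) on `⁰𝒮`). The remaining vocabulary (§2 cells / engine, §3 certificate / IR clustering /
deployment, §4 legs) lands with the stubs that consume it. Registered stubs are matched by name.

Sources: Georgii (2011) Def. 1.23 / 2.9, Ch. 8; Friedli–Velenik (2017) §6.10.1; Bałaban, CMP 119 (1988)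
p. 259–261; Jaffe–Witten (2000) §5 (uniform finite-volume gap).
-/

set_option autoImplicit false

noncomputable section

namespace Summit.QuantumFields.QCD.Cruxes.RobustYangMills.LocalAcOpenCertificate

open scoped BigOperators Topology ENNReal
open Filter MeasureTheory
open Literature.MathematicalPhysics.QuantumLattice Literature.MathematicalPhysics.AQFT
  Literature.MathematicalPhysics.QuantumFieldTheory

/-! ## §0 The crux's vocabulary, named -/

/-- `SU(3)`. -/
abbrev SU3 : Type := ↥(Matrix.specialUnitaryGroup (Fin 3) ℂ)

/-- The fundamental representation of `SU(3)` (the crux's `ρ`). -/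
abbrev ρ₃ : SU3 →* Matrix (Fin 3) (Fin 3) ℂ := fundamentalRep (Fin 3)

/-- The crux's lattice representation datum `r₃`. -/
def r₃ : LatticeRep SU3 :=
  ⟨3, ρ₃, continuous_fundamentalRep _, fundamentalRep_injective _, fundamentalRep_mem_unitaryGroup⟩

/-- Families of perturbations indexed by the level `k` and the torus half-side `S`, at block scale `⌊ℓ₀/a_k⌋`. -/
abbrev Family (a : ℕ → ℝ) (ℓ₀ : ℝ) : Type :=
  (k : ℕ) → (S : ℕ) → QuasiLocalGaugePerturbation 4 (2 * S + 1) SU3 ⌊ℓ₀ / a k⌋₊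

/-- **Admissibility at level `k`** (verbatim the crux's `AdmAt`, `(κ, η)` explicit): (h1) lattice symmetries of the total, (h2) reflection positivity, (h3) `NormLE κ η`, (h4) range control. -/
def AdmAt (κ η : ℝ) (a : ℕ → ℝ) (L : ℕ → ℕ) (β' : ℕ → ℝ) (ℓ₀ : ℝ) (W : Family a ℓ₀) (k : ℕ) : Prop :=
  ∀ S : ℕ, L k ≤ S →
    (∀ (v : Site 4 (2 * S + 1)) (U : GaugeConfig 4 (2 * S + 1) SU3),
      (W k S).total (torusConfigShift v U) = (W k S).total U) ∧
    (∀ U : GaugeConfig 4 (2 * S + 1) SU3, (W k S).total (GaugeConfig.timeReflect U) = (W k S).total U) ∧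
    (∀ (π : Equiv.Perm (Fin 4)) (U : GaugeConfig 4 (2 * S + 1) SU3),
      (W k S).total (fun e => U (e.1 ∘ π, π.symm e.2)) = (W k S).total U) ∧
    (W k S).IsReflectionPositive ρ₃ (β' k) ∧
    (W k S).NormLE κ η ∧
    (∀ X : Finset (Site 4 (2 * S + 1)), X ∈ polymers ⌊ℓ₀ / a k⌋₊ →
      (∃ U : GaugeConfig 4 (2 * S + 1) SU3, (W k S).act X U ≠ 0) →
      ∀ y ∈ X, ∀ y' ∈ X, ∀ i : Fin 4,
        (y i - y' i).val ≤ ⌊ℓ₀ / a k⌋₊ * X.card ∨ (y' i - y i).val ≤ ⌊ℓ₀ / a k⌋₊ * X.card)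

/-- The species scheme of the crux's data with renormalisations `(c, m)`. -/
abbrev sch (a : ℕ → ℝ) (L : ℕ → ℕ) (ha : ∀ k, 0 < a k) (ha₀ : Tendsto a atTop (𝓝 0))
    (haL : Tendsto (fun k => a k * L k) atTop atTop) (β' : ℕ → ℝ) (c m : YMSpecies SU3 → ℕ → ℝ) :
    SpeciesScheme (YMSpecies SU3) :=
  ⟨a, ha, ha₀, β', L, haL, c, m⟩

/-- **Clause (i′)**: convergence of the perturbed lattice Schwinger functions on `⁰𝒮` along `φ` to `T`. -/
def ClauseConv (a : ℕ → ℝ) (L : ℕ → ℕ) (ha : ∀ k, 0 < a k) (ha₀ : Tendsto a atTop (𝓝 0))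
    (haL : Tendsto (fun k => a k * L k) atTop atTop) (β' : ℕ → ℝ) (ℓ₀ : ℝ) (W : Family a ℓ₀)
    (φ : ℕ → ℕ) (c m : YMSpecies SU3 → ℕ → ℝ) (T : OSData (YMSpecies SU3) 4) : Prop :=
  ∀ n : ℕ, n ≠ 0 → ∀ (σ : Fin n → YMSpecies SU3) (f : Fin n → SchwartzMap (EuclideanSpace ℝ (Fin 4)) ℝ)
    (F : SchwartzMap (Fin n → EuclideanSpace ℝ (Fin 4)) ℂ),
    IsTensorOf F (fun i => ofRealTest (f i)) → IsOffDiagonal F →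
      Tendsto (fun j : ℕ => ((perturbedLatticeSchwinger ρ₃ (sch a L ha ha₀ haL β' c m)
        (fun k => W k (L k)) (fun s => s.F) (φ j) n σ f : ℝ) : ℂ)) atTop (𝓝 (T.schwinger n σ F))

/-- **Clause (iii′)** at rate `Δ`: uniform lattice clustering of all species pairs on all tori `S ≥ L_k`. -/
def ClauseCluster (a : ℕ → ℝ) (L : ℕ → ℕ) (β' : ℕ → ℝ) (ℓ₀ : ℝ) (W : Family a ℓ₀) (Δ : ℝ) : Prop :=
  ∀ A B : YMSpecies SU3, ∃ C : ℝ, ∀ᶠ k in atTop, ∀ S : ℕ, L k ≤ S → ∀ n : ℕ, n ≤ S →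
    |(W k S).connectedCorr ρ₃ (β' k) A.F B.F n| ≤ C * Real.exp (-(Δ * (a k * n)))

/-- **Clause (iv)**: the `k`-uniform Lipschitz bound in `W` (all `n`, all smearings). -/
def ClauseLip (κ η : ℝ) (a : ℕ → ℝ) (L : ℕ → ℕ) (ha : ∀ k, 0 < a k) (ha₀ : Tendsto a atTop (𝓝 0))
    (haL : Tendsto (fun k => a k * L k) atTop atTop) (β' : ℕ → ℝ) (ℓ₀ : ℝ) (W : Family a ℓ₀)
    (c m : YMSpecies SU3 → ℕ → ℝ) : Prop :=
  ∀ (n : ℕ) (σ : Fin n → YMSpecies SU3) (f : Fin n → SchwartzMap (EuclideanSpace ℝ (Fin 4)) ℝ),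
    ∃ C : ℝ, ∀ᶠ k in atTop, ∀ W', AdmAt κ η a L β' ℓ₀ W' k → ∀ δ : ℝ, 0 ≤ δ →
      (∀ S : ℕ, L k ≤ S → (W k S - W' k S).NormLE κ δ) →
        |perturbedLatticeSchwinger ρ₃ (sch a L ha ha₀ haL β' c m) (fun k => W k (L k)) (fun s => s.F) k n σ f -
          perturbedLatticeSchwinger ρ₃ (sch a L ha ha₀ haL β' c m) (fun k => W' k (L k)) (fun s => s.F) k n σ f|
          ≤ C * δ

/-- **Clause (iv) on `⁰𝒮`**: the bound for `n ≠ 0` and off-diagonal smearing tensors. -/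
def ClauseLipOff (κ η : ℝ) (a : ℕ → ℝ) (L : ℕ → ℕ) (ha : ∀ k, 0 < a k) (ha₀ : Tendsto a atTop (𝓝 0))
    (haL : Tendsto (fun k => a k * L k) atTop atTop) (β' : ℕ → ℝ) (ℓ₀ : ℝ) (W : Family a ℓ₀)
    (c m : YMSpecies SU3 → ℕ → ℝ) : Prop :=
  ∀ n : ℕ, n ≠ 0 → ∀ (σ : Fin n → YMSpecies SU3) (f : Fin n → SchwartzMap (EuclideanSpace ℝ (Fin 4)) ℝ)
    (F : SchwartzMap (Fin n → EuclideanSpace ℝ (Fin 4)) ℂ),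
    IsTensorOf F (fun i => ofRealTest (f i)) → IsOffDiagonal F →
    ∃ C : ℝ, ∀ᶠ k in atTop, ∀ W', AdmAt κ η a L β' ℓ₀ W' k → ∀ δ : ℝ, 0 ≤ δ →
      (∀ S : ℕ, L k ≤ S → (W k S - W' k S).NormLE κ δ) →
        |perturbedLatticeSchwinger ρ₃ (sch a L ha ha₀ haL β' c m) (fun k => W k (L k)) (fun s => s.F) k n σ f -
          perturbedLatticeSchwinger ρ₃ (sch a L ha ha₀ haL β' c m) (fun k => W' k (L k)) (fun s => s.F) k n σ f|
          ≤ C * δ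

/-- **Clause (iv), provable fragment** (reshape r2): the instances with `n = 0` or an off-diagonal tensor. -/
def ClauseLipFrag (κ η : ℝ) (a : ℕ → ℝ) (L : ℕ → ℕ) (ha : ∀ k, 0 < a k) (ha₀ : Tendsto a atTop (𝓝 0))
    (haL : Tendsto (fun k => a k * L k) atTop atTop) (β' : ℕ → ℝ) (ℓ₀ : ℝ) (W : Family a ℓ₀)
    (c m : YMSpecies SU3 → ℕ → ℝ) : Prop :=
  ∀ (n : ℕ) (σ : Fin n → YMSpecies SU3) (f : Fin n → SchwartzMap (EuclideanSpace ℝ (Fin 4)) ℝ),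
    (n = 0 ∨ ∃ F : SchwartzMap (Fin n → EuclideanSpace ℝ (Fin 4)) ℂ,
      IsTensorOf F (fun i => ofRealTest (f i)) ∧ IsOffDiagonal F) →
    ∃ C : ℝ, ∀ᶠ k in atTop, ∀ W', AdmAt κ η a L β' ℓ₀ W' k → ∀ δ : ℝ, 0 ≤ δ →
      (∀ S : ℕ, L k ≤ S → (W k S - W' k S).NormLE κ δ) →
        |perturbedLatticeSchwinger ρ₃ (sch a L ha ha₀ haL β' c m) (fun k => W k (L k)) (fun s => s.F) k n σ f -
          perturbedLatticeSchwinger ρ₃ (sch a L ha ha₀ haL β' c m) (fun k => W' k (L k)) (fun s => s.F) k n σ f|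
          ≤ C * δ

/-- **Clause (iv), coincident residual** (reshape r2, SUSPECT content): `n ≠ 0` and NO off-diagonal tensor — clause (iv) of the crux at coincident smearings. -/
def ClauseLipCoin (κ η : ℝ) (a : ℕ → ℝ) (L : ℕ → ℕ) (ha : ∀ k, 0 < a k) (ha₀ : Tendsto a atTop (𝓝 0))
    (haL : Tendsto (fun k => a k * L k) atTop atTop) (β' : ℕ → ℝ) (ℓ₀ : ℝ) (W : Family a ℓ₀)
    (c m : YMSpecies SU3 → ℕ → ℝ) : Prop :=
  ∀ (n : ℕ) (σ : Fin n → YMSpecies SU3) (f : Fin n → SchwartzMap (EuclideanSpace ℝ (Fin 4)) ℝ),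
    ¬ (n = 0 ∨ ∃ F : SchwartzMap (Fin n → EuclideanSpace ℝ (Fin 4)) ℂ,
      IsTensorOf F (fun i => ofRealTest (f i)) ∧ IsOffDiagonal F) →
    ∃ C : ℝ, ∀ᶠ k in atTop, ∀ W', AdmAt κ η a L β' ℓ₀ W' k → ∀ δ : ℝ, 0 ≤ δ →
      (∀ S : ℕ, L k ≤ S → (W k S - W' k S).NormLE κ δ) →
        |perturbedLatticeSchwinger ρ₃ (sch a L ha ha₀ haL β' c m) (fun k => W k (L k)) (fun s => s.F) k n σ f -
          perturbedLatticeSchwinger ρ₃ (sch a L ha ha₀ haL β' c m) (fun k => W' k (L k)) (fun s => s.F) k n σ f|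
          ≤ C * δ

/-- **The crux's conclusion for `W`** (verbatim): subsequence, renormalisations, `T`, `Δ > 0` with (i′), (ii), gap, (iii′), (iv). -/
def Concl (κ η : ℝ) (a : ℕ → ℝ) (L : ℕ → ℕ) (ha : ∀ k, 0 < a k) (ha₀ : Tendsto a atTop (𝓝 0))
    (haL : Tendsto (fun k => a k * L k) atTop atTop) (β' : ℕ → ℝ) (ℓ₀ : ℝ) (W : Family a ℓ₀) : Prop :=
  ∃ φ : ℕ → ℕ, StrictMono φ ∧ ∃ (c m : YMSpecies SU3 → ℕ → ℝ) (T : OSData (YMSpecies SU3) 4) (Δ : ℝ),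
    0 < Δ ∧ ClauseConv a L ha ha₀ haL β' ℓ₀ W φ c m T ∧ T.IsNontrivial r₃.curvature ∧
      T.IsNonGaussian r₃.curvature ∧ T.HasMassGap Δ ∧ ClauseCluster a L β' ℓ₀ W Δ ∧
      ClauseLip κ η a L ha ha₀ haL β' ℓ₀ W c m

/-- The budget of the crux at block scale `ℓ₀`: `η₀ / max 1 (afBeta 0 Λ' ℓ₀)`. -/
def budget (η₀ Λ' ℓ₀ : ℝ) : ℝ := η₀ / max 1 (afBeta 0 Λ' ℓ₀)

/-- **The crux in named form** (`∃ η₀ κ` stripped). -/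
def Explicit (η₀ κ : ℝ) : Prop :=
  ∀ (a : ℕ → ℝ) (L : ℕ → ℕ) (ha : ∀ k, 0 < a k) (ha₀ : Tendsto a atTop (𝓝 0))
    (haL : Tendsto (fun k => a k * L k) atTop atTop) (β' : ℕ → ℝ) (Λ' : ℝ), 0 < Λ' →
    Tendsto (fun k => β' k - afBeta 0 Λ' (a k)) atTop (𝓝 0) → ∀ ℓ₀ : ℝ, 0 < ℓ₀ →
    ∀ W : Family a ℓ₀, (∀ᶠ k in atTop, AdmAt κ (budget η₀ Λ' ℓ₀) a L β' ℓ₀ W k) →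
      Concl κ (budget η₀ Λ' ℓ₀) a L ha ha₀ haL β' ℓ₀ W

/-! ## §1 The perturbed torus specification and the local-absolute-continuity toolkit (stub A) -/

section Spec

open Literature.Probability.LatticeModels (Specification IsSpecification IsGibbsMeasure glueWith)

variable {G : Type} [Group G] [TopologicalSpace G] [IsTopologicalGroup G] [CompactSpace G]
  [MeasurableSpace G] [BorelSpace G]

/-- **The perturbed torus specification** `γ^{β,W}_Λ(· | ζ)`: product Haar on the links of `Λ` glued with `ζ`, tilted by `-β S_W - W.total` (its kernels are the DLR conditional laws of `W.perturbedMeasure ρ β`). [folklore] -/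
def spec {N Lt : ℕ} [NeZero Lt] {b : ℕ} (ρ : G →* Matrix (Fin N) (Fin N) ℂ) (β : ℝ)
    (W : QuasiLocalGaugePerturbation 4 Lt G b) : Specification (Edge 4 Lt) G :=
  fun Λ ζ => ((Measure.pi fun _ : ↥Λ => haarProbability G).map (glueWith Λ · ζ)).tilted
    fun U => -β * wilsonAction ρ U - W.total U

/-- Wilson's torus specification = the perturbed one at `W = 0`. -/
abbrev wilsonSpec {N Lt : ℕ} [NeZero Lt] (ρ : G →* Matrix (Fin N) (Fin N) ℂ) (β : ℝ) :
    Specification (Edge 4 Lt) G :=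
  spec ρ β (0 : QuasiLocalGaugePerturbation 4 Lt G 1)

/-- **Range control (h4)** of one perturbation (verbatim the crux's clause). -/
def RangeControl {Lt : ℕ} [NeZero Lt] {b : ℕ} (W : QuasiLocalGaugePerturbation 4 Lt G b) : Prop :=
  ∀ X : Finset (Site 4 Lt), X ∈ polymers b → (∃ U : GaugeConfig 4 Lt G, W.act X U ≠ 0) →
    ∀ y ∈ X, ∀ y' ∈ X, ∀ i : Fin 4, (y i - y' i).val ≤ b * X.card ∨ (y' i - y i).val ≤ b * X.card

/-- The block corner `y'` is `M` blocks near the corner set `R` (coordinatewise, either way round the torus). -/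
def NearBlocks {Lt : ℕ} (b : ℕ) (R : Finset (Site 4 Lt)) (M : ℕ) (y' : Site 4 Lt) : Prop :=
  ∃ y ∈ R, ∀ i : Fin 4, (y i - y' i).val ≤ b * M ∨ (y' i - y i).val ≤ b * M

/-- **(a)** two-sided density continuity of the kernels in `W`: `‖W - W'‖_{b,κ} ≤ δ`, `κ ≥ 0` ⇒ factor `e^{2δ|R|}` on regions of links of the blocks `R`. -/
def KernelACInW : Prop :=
  ∀ (G : Type) [Group G] [TopologicalSpace G] [IsTopologicalGroup G] [CompactSpace G]
    [MeasurableSpace G] [BorelSpace G] [SecondCountableTopology G] [MeasurableSingletonClass G]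
    (N : ℕ) (ρ : G →* Matrix (Fin N) (Fin N) ℂ), Continuous ρ →
    ∀ (Lt : ℕ) [NeZero Lt] (b : ℕ) (β : ℝ) (W W' : QuasiLocalGaugePerturbation 4 Lt G b) (κ δ : ℝ),
      0 ≤ κ → (W - W').NormLE κ δ →
      ∀ R : Finset (Site 4 Lt), R ⊆ blockCorners b →
      ∀ Λ : Finset (Edge 4 Lt), (∀ e ∈ Λ, blockCorner b e.1 ∈ R) →
      ∀ (ζ : GaugeConfig 4 Lt G) (f : GaugeConfig 4 Lt G → ℝ), Measurable f → (∀ U, 0 ≤ f U ∧ f U ≤ 1) →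
        ∫ U, f U ∂(spec ρ β W Λ ζ) ≤ Real.exp (2 * δ * R.card) * ∫ U, f U ∂(spec ρ β W' Λ ζ) ∧
        ∫ U, f U ∂(spec ρ β W' Λ ζ) ≤ Real.exp (2 * δ * R.card) * ∫ U, f U ∂(spec ρ β W Λ ζ)

/-- **(b)** quasi-locality of the kernels (reshape r1): exteriors agreeing `(m+1)`-near `R` and `f` reading only `Λ` and agreeing links ⇒ factor `exp(4η e^{-κm}|R|)`. -/
def KernelQuasiLocality : Prop :=
  ∀ (G : Type) [Group G] [TopologicalSpace G] [IsTopologicalGroup G] [CompactSpace G]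
    [MeasurableSpace G] [BorelSpace G] [SecondCountableTopology G] [MeasurableSingletonClass G]
    (N : ℕ) (ρ : G →* Matrix (Fin N) (Fin N) ℂ), Continuous ρ →
    ∀ (Lt : ℕ) [NeZero Lt] (b : ℕ) (β : ℝ) (W : QuasiLocalGaugePerturbation 4 Lt G b) (κ η : ℝ),
      1 ≤ b → 0 ≤ κ → W.NormLE κ η → RangeControl W →
      ∀ R : Finset (Site 4 Lt), R ⊆ blockCorners b →
      ∀ Λ : Finset (Edge 4 Lt), (∀ e ∈ Λ, blockCorner b e.1 ∈ R) →
      ∀ (m : ℕ) (ζ ζ' : GaugeConfig 4 Lt G),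
        (∀ e : Edge 4 Lt, NearBlocks b R (m + 1) (blockCorner b e.1) → ζ e = ζ' e) →
      ∀ f : GaugeConfig 4 Lt G → ℝ, Measurable f → (∀ U, 0 ≤ f U ∧ f U ≤ 1) →
        DependsOn f {e : Edge 4 Lt | e ∈ Λ ∨ ζ e = ζ' e} →
        ∫ U, f U ∂(spec ρ β W Λ ζ) ≤
          Real.exp (4 * (η * Real.exp (-(κ * m))) * R.card) * ∫ U, f U ∂(spec ρ β W Λ ζ')

/-- **(c)** the kernels form a Georgii specification and `μ_{β,W}` is Gibbs for it. -/
def KernelDLR : Prop :=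
  ∀ (G : Type) [Group G] [TopologicalSpace G] [IsTopologicalGroup G] [CompactSpace G]
    [MeasurableSpace G] [BorelSpace G] [SecondCountableTopology G] [MeasurableSingletonClass G]
    (N : ℕ) (ρ : G →* Matrix (Fin N) (Fin N) ℂ), Continuous ρ →
    ∀ (Lt : ℕ) [NeZero Lt] (b : ℕ) (β : ℝ) (W : QuasiLocalGaugePerturbation 4 Lt G b),
      IsSpecification (spec ρ β W) ∧ IsGibbsMeasure (spec ρ β W) (W.perturbedMeasure ρ β)

/-- **The local-absolute-continuity toolkit** `(a) ∧ (b) ∧ (c)` (statement of `stub_localAC`, CLOSED). -/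
def LocalACToolkit : Prop :=
  KernelACInW ∧ KernelQuasiLocality ∧ KernelDLR

end Spec

/-! ## §4 (part) The two halves of the former `DiagonalExtension` (lead's reshape r2) -/

/-- **Diagonal extension, provable fragment** (statement of `stub_diagonalFragment`): (iv) on `⁰𝒮` ⇒ `ClauseLipFrag`. -/
def DiagonalFragment : Prop :=
  ∀ (κ η : ℝ) (a : ℕ → ℝ) (L : ℕ → ℕ) (ha : ∀ k, 0 < a k) (ha₀ : Tendsto a atTop (𝓝 0))
    (haL : Tendsto (fun k => a k * L k) atTop atTop) (β' : ℕ → ℝ) (Λ' : ℝ), 0 < Λ' →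
    Tendsto (fun k => β' k - afBeta 0 Λ' (a k)) atTop (𝓝 0) →
    ∀ ℓ₀ : ℝ, 0 < ℓ₀ → ∀ W : Family a ℓ₀, (∀ᶠ k in atTop, AdmAt κ η a L β' ℓ₀ W k) →
    ∀ (φ : ℕ → ℕ) (c m : YMSpecies SU3 → ℕ → ℝ) (T : OSData (YMSpecies SU3) 4) (Δ : ℝ),
      StrictMono φ → ClauseConv a L ha ha₀ haL β' ℓ₀ W φ c m T → T.IsNontrivial r₃.curvature →
      0 < Δ → ClauseCluster a L β' ℓ₀ W Δ →
      ClauseLipOff κ η a L ha ha₀ haL β' ℓ₀ W c m → ClauseLipFrag κ η a L ha ha₀ haL β' ℓ₀ W c m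

/-- **Coincident response** (statement of `stub_coincidentResponse`, SUSPECT): the coincident instances of clause (iv). -/
def CoincidentResponse : Prop :=
  ∀ (κ η : ℝ) (a : ℕ → ℝ) (L : ℕ → ℕ) (ha : ∀ k, 0 < a k) (ha₀ : Tendsto a atTop (𝓝 0))
    (haL : Tendsto (fun k => a k * L k) atTop atTop) (β' : ℕ → ℝ) (Λ' : ℝ), 0 < Λ' →
    Tendsto (fun k => β' k - afBeta 0 Λ' (a k)) atTop (𝓝 0) →
    ∀ ℓ₀ : ℝ, 0 < ℓ₀ → ∀ W : Family a ℓ₀, (∀ᶠ k in atTop, AdmAt κ η a L β' ℓ₀ W k) →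
    ∀ (φ : ℕ → ℕ) (c m : YMSpecies SU3 → ℕ → ℝ) (T : OSData (YMSpecies SU3) 4) (Δ : ℝ),
      StrictMono φ → ClauseConv a L ha ha₀ haL β' ℓ₀ W φ c m T → T.IsNontrivial r₃.curvature →
      0 < Δ → ClauseCluster a L β' ℓ₀ W Δ →
      ClauseLipOff κ η a L ha ha₀ haL β' ℓ₀ W c m → ClauseLipCoin κ η a L ha ha₀ haL β' ℓ₀ W c m

/-! ## Closed stubs -/

/-- **`stub_localAC` (CLOSED)** — the local-absolute-continuity toolkit of the perturbed torus
specification: (a) two-sided density continuity of the kernels in `W` at rate `e^{2δ|R|}`; (b) quasi-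
locality in the exterior at rate `exp(4 η e^{-κ m} |R|)` under range control; (c) the kernels form a
Georgii specification for which `μ_{β,W}` is Gibbs. Proof: `spec`, `RangeControl`, `NearBlocks` unfold
definitionally to the hypotheses of `QuasiLocalGaugePerturbation.integral_kernel_le_exp_mul_of_normLE_sub`,
`….integral_kernel_le_exp_mul_of_exterior_eq`, `….isSpecification_and_isGibbsMeasure_perturbedMeasure`
(Literature `QuasiLocalGaugePerturbationKernels`, landed by this seat's wave-1 worker). -/
theorem stub_localAC : LocalACToolkit := by
  refine ⟨?_, ?_, ?_⟩
  · intro G _ _ _ _ _ _ _ _ N ρ hρ Lt _ b β W W' κ δ hκ hW R hR Λ hΛ ζ f hf hf01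
    exact QuasiLocalGaugePerturbation.integral_kernel_le_exp_mul_of_normLE_sub ρ hρ β W W' hκ hW hR
      hΛ ζ hf hf01
  · intro G _ _ _ _ _ _ _ _ N ρ hρ Lt _ b β W κ η hb hκ hW hRC R hR Λ hΛ m ζ ζ' hζ f hf hf01 hdep
    exact QuasiLocalGaugePerturbation.integral_kernel_le_exp_mul_of_exterior_eq ρ hρ hb β W hκ hW
      hRC hR hΛ m hζ hf hf01 hdep
  · intro G _ _ _ _ _ _ _ _ N ρ hρ Lt _ b β W
    exact QuasiLocalGaugePerturbation.isSpecification_and_isGibbsMeasure_perturbedMeasure ρ hρ β W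

/-- The `0`-point perturbed lattice Schwinger function of `SU(3)` is `1`: the expectation of the empty
product under the probability measure `μ_{β,W}` (DLR fact (c) makes it a probability measure). -/
theorem perturbedLatticeSchwinger_zero_points (S : SpeciesScheme (YMSpecies SU3)) {bs : ℕ → ℕ}
    (W : (k : ℕ) → QuasiLocalGaugePerturbation 4 (S.side k) SU3 (bs k)) (k : ℕ)
    (σ : Fin 0 → YMSpecies SU3) (f : Fin 0 → SchwartzMap (EuclideanSpace ℝ (Fin 4)) ℝ) :
    perturbedLatticeSchwinger ρ₃ S W (fun s => s.F) k 0 σ f = 1 := by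
  haveI : IsProbabilityMeasure ((W k).perturbedMeasure ρ₃ (S.β k)) :=
    (QuasiLocalGaugePerturbation.isSpecification_and_isGibbsMeasure_perturbedMeasure ρ₃
      (continuous_fundamentalRep _) (S.β k) (W k)).2.1
  simp only [perturbedLatticeSchwinger, QuasiLocalGaugePerturbation.expectation,
    Finset.univ_eq_empty, Finset.prod_empty, integral_const, probReal_univ, one_smul]

/-- **(iv) on `⁰𝒮` implies the fragment `ClauseLipFrag`** of the verbatim clause (iv): the `n = 0`
instance holds with `C = 0` (both `0`-point functions are `1`), every other instance of the fragment
comes with an off-diagonal tensor and is an instance of `ClauseLipOff`. -/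
theorem clauseLipFrag_of_clauseLipOff {κ η : ℝ} {a : ℕ → ℝ} {L : ℕ → ℕ} {ha : ∀ k, 0 < a k}
    {ha₀ : Tendsto a atTop (𝓝 0)} {haL : Tendsto (fun k => a k * L k) atTop atTop} {β' : ℕ → ℝ}
    {ℓ₀ : ℝ} {W : Family a ℓ₀} {c m : YMSpecies SU3 → ℕ → ℝ}
    (hOff : ClauseLipOff κ η a L ha ha₀ haL β' ℓ₀ W c m) :
    ClauseLipFrag κ η a L ha ha₀ haL β' ℓ₀ W c m := by
  intro n σ f h
  rcases Nat.eq_zero_or_pos n with rfl | hn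
  · refine ⟨0, Eventually.of_forall fun k W' _ δ _ _ => ?_⟩
    rw [perturbedLatticeSchwinger_zero_points, perturbedLatticeSchwinger_zero_points, sub_self,
      abs_zero, zero_mul]
  · rcases h with h0 | ⟨F, hF, hFoff⟩
    · exact absurd h0 hn.ne'
    · exact hOff n hn.ne' σ f F hF hFoff

/-- **`stub_diagonalFragment` (CLOSED)**: clause (iv) on `⁰𝒮` implies the fragment `ClauseLipFrag`
(`n = 0` or an off-diagonal tensor exists), for every admissibility datum and every witness — the
hypotheses other than `ClauseLipOff` are not needed. -/
theorem stub_diagonalFragment : DiagonalFragment :=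
  fun _ _ _ _ _ _ _ _ _ _ _ _ _ _ _ _ _ _ _ _ _ _ _ _ _ hOff => clauseLipFrag_of_clauseLipOff hOff

end Summit.QuantumFields.QCD.Cruxes.RobustYangMills.LocalAcOpenCertificate

end
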